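import Summits.NavierStokesRegularity.NavierStokesRegularity.Theses.CoriolisHead
import Summits.NavierStokesRegularity.NavierStokesRegularity.Theorems.CoriolisHeadNoCoRotatingCoreReduction
import Summits.NavierStokesRegularity.NavierStokesRegularity.Theorems.CoriolisHeadFarFieldCovarianceFrame
import HarnessLib.Audit

/-!
# Skeleton of the crux `CoriolisHead.NoCoRotatingCore` — line `far-field-constancy`, v2 (RESCUER line, ns-idea-10 g2)
(crux item `stmt-NavierStokesRegularity-22676`; planner seat `ns-idea-10` (D-0145 ideator, lens «rescuer»); v1 = commit
dfea78de5840 (g0, 2026-08-28T02:39Z, critic idea-crit-8 PASS-WITH-PRICE 02:56Z); v2 = this file, 2026-08-28 g2.)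

WHAT CHANGED v1 → v2 (why a second version).  (a) v1's support stub `stub_translationCovariance` (P1) and the
critic's price P2′ (frame reduction) LANDED as tree theorems — `Theorems.CoriolisHead.farField_translationCovariance`
(p604442) and `Theorems.CoriolisHead.decayingRotatedLiouville_of_pineauVicolFrame` / `…_iff_pineauVicolFrame` (p605289)
— so they are now CITED BY NAME (no stub); the declared residual is restated in Pineau–Vicol's PRINTED frame
(`stub_pineauVicolConjecture` = Conjecture 1.1 verbatim: frame `(1, ½, αJ)`, `α ≠ 0`) and lifted to the general frame by
the landed reduction.  (b) The line's one NEW crux K1 (`stub_farFieldConstancy` in v1: bounded profile ⇒ `b + O(1/|y|)`),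
whose LINEAR instrument came back «constants only» (card rev 3/4; critic read-note 04:16Z), is SPLIT (layer 2, glued,
k = 3) along the seams that the instrument exposed, so that the keyed specialist seat `ns-ffc-k1` (director-ns req118 (1):
«K1 in the order K1a → K1b → K1c») has typed targets:
  * K1a `stub_scaleNaturalDecay` (crux, the hard core): a bounded profile has SCALE-NATURAL DERIVATIVE DECAY
    `r‖∇U(y)‖ + r²‖∇²U(y)‖ → 0` (`r = ‖y‖ → ∞`).  In the time picture: `√(T−t)·|∇u(x,t)| → 0` at every `x ≠ x₀` while
    `|u|` itself blows up at the Type-I rate everywhere — the gradient is below the self-similar rate off-centre.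
  * K1b `stub_farFieldLimit` (support, sketch-proved in the card): K1a ⇒ `U → b` uniformly at infinity.  With K1a the
    drift term `(V·∇)U`, `V = ay − By`, `|V| ~ r`, and `G = νΔU − (U·∇)U` tend to `0`, so `∇P` is bounded; `div` of the
    linear part vanishes identically (`div((V·∇)U) + div((aI+B)U) = 0` for skew `B`), hence `ΔP = −tr((∇U)²) = O(ε(r)²/r²)`;
    its Newtonian potential has vanishing gradient at infinity (shell estimate), the harmonic remainder has bounded
    gradient ⇒ `∇P → g` (Liouville); along the outward spiral characteristics of `V`: `dU/ds + (aI+B)U = −g + o(1)` ⇒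
    `U → b = −(aI+B)⁻¹g` uniformly (`⟨(aI+B)x,x⟩ = a‖x‖²` ⇒ invertible).
  * K1c `stub_typeIRate` (crux, borderline): K1a ∧ `U → b` ⇒ the Type-I RATE `‖U − b‖ ≤ K/(1+‖y‖)`.  The homogeneous
    decay `e^{−as} = r₀/r` along characteristics is EXACTLY the claimed rate, so a resonant forcing loses a logarithm
    (`(log r)/r`) unless the forcing gains a power — an ε-regularity statement for rotated self-similar solutions at
    `(x₀,T)`, `x₀ ≠ 0`, below `L^{3,∞}` (Pineau–Vicol Prop. 3.1 flavour); recentring (landed P1, any `o(1)`-variant) may be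
    used first inside the proof.
  `farFieldConstancy_of : K1a → K1b → K1c → K1` is PROVED below (three-line logic), so K1 keeps its v1 statement verbatim
  and the v1 composition `rotatedProfileLiouville_of` is reused unchanged.

THE CORPSE AND ITS RECORDED DEATH (unchanged).  `NoCoRotatingCore` is, by the landed equivalence
`Theorems.CoriolisHead.noCoRotatingCore_iff_rotatedProfileLiouville`, the BOUNDED rotated-profile Liouville theorem
«every bounded smooth solution of `−νΔU + aU + a(y·∇)U + (BU − (By·∇)U) + (U·∇)U + ∇P = 0`, `div U = 0`
(`ν, a > 0`, `B` skew) is constant» — Pineau–Vicol's Conjecture 1.1 WITHOUT their Type-I decay hypothesis (1.9) and at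
EVERY rotation rate.  Recorded death (ns-idea-6 g0–g3, cstrat-22676): every pointwise maximum-principle scalar (`Π_B`, `ω_β`,
`|ω|²`, positive parts) has an unsigned Coriolis feed; on the invariant-density average the rotation is exactly CO-rotating;
residue ≡ the open problem; and on the BOUNDED class none of Pineau–Vicol's weighted-`L²` machinery (built on decay (1.9))
is available.  THE DODGE: far-field constancy at the Type-I rate (K1 = K1a ∧ K1b ∧ K1c) + translation covariance (landed)
move the residue onto the DECAYING class, where it is EXACTLY the printed conjecture (landed iff) and where the
max-principle-insensitive weighted-`L²` class applies (Thm 1.4 decides the extreme rates: tree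
`Literature.Analysis.FluidPDE.pineauVicol2026_rss_liouville`, `Theorems.CoriolisHead.noCoRotatingCore_of_pvAnsatz_extreme_rotation`).

COMPOSITION (kernel-checked, `sorry` only inside the four `stub_*`): `farFieldConstancy_of` (K1a, K1b, K1c ⟹ K1),
`rotatedProfileLiouville_of` (K1, landed P1, residual ⟹ the bounded Liouville statement `X`), `NoCoRotatingCore_of`
(⟹ the crux BY NAME via the landed iff; the residual enters through the landed `decayingRotatedLiouville_of_pineauVicolFrame`).
HONEST FRAMING: nothing here proves `NoCoRotatingCore`, `SpiralScalingLiouville`, Pineau–Vicol's conjecture or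
Navier–Stokes regularity; K1a and K1c are open, K1b is sketch-proved only, the residual is a named printed open problem.
No summit is proved by a line.  bears_on: «N0» — route CoriolisHead (host crux SpiralScalingLiouville 8216, residual
ExtremalSpiralSymmetry 8215, hard core 0056).

References: B. Pineau, V. Vicol, arXiv:2607.09619 (2026), Conj. 1.1, Rem. 1.2–1.3, Thm 1.4, Prop. 3.1, §5
[PineauVicol2026]; T.-P. Tsai, ARMA 143 (1998) [Tsai1998]; G. Koch, N. Nadirashvili, G. Seregin, V. Šverák, Acta Math.
203 (2009) [KNSS2009]; H. Jia, V. Šverák, Invent. Math. 196 (2014), §4 (far-field expansions of self-similar profiles)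
[JiaSverak2014]; D. Gilbarg, N. Trudinger, *Elliptic PDE of Second Order*, §2.4–§4.2 (Newtonian potential, harmonic
Liouville) [GilbargTrudinger].
-/

noncomputable section

open Set Filter Topology
open scoped RealInnerProductSpace BigOperators
open Literature.Analysis.FluidPDE

namespace Summit.NavierStokesRegularity.NavierStokesRegularity.Cruxes.NoCoRotatingCore.FarFieldConstancy

open Summit.NavierStokesRegularity.NavierStokesRegularity.Theses
open Summit.NavierStokesRegularity.NavierStokesRegularity.Theorems.CoriolisHead

set_option linter.unusedVariables false
set_option linter.dupNamespace false

local notation "E3" => EuclideanSpace ℝ (Fin 3)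

/-- **stub K1a — `stub_scaleNaturalDecay` (crux, rank 2 of the line; the hard core; XL).**  Every bounded smooth rotated
self-similar profile has SCALE-NATURAL DERIVATIVE DECAY: `‖y‖·‖DU(y)‖ + ‖y‖²·‖D²U(y)‖ → 0` as `‖y‖ → ∞` (stated with
an explicit `ε`–`R`).  Plain `DU → 0` would not suffice downstream: the drift `V = ay − By` has `|V| ~ r`, so `(V·∇)U`
is `O(r‖DU‖)`.  Why it might fail: a bounded profile whose far field keeps `O(1/r)` gradients in the spiral/angular
direction at scale `r` (a transported non-decaying pattern sustained by the pressure), or an upward-coupled derivative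
hierarchy with `O(1)` couplings (Δ is a singular perturbation at large `r`; blow-down limits `U(y_n + ·)` obey a reduced
2-D system with an unknown forcing `lim r_n ∂_ê U_n`).  Sources: KNSS2009 (a-priori derivative bounds for bounded profiles;
tree `CoriolisHeadNoCoRotatingCoreUniformDerivatives`); JiaSverak2014 §4; PineauVicol2026 Rem. 1.3. [status: open] -/
theorem stub_scaleNaturalDecay :
    ∀ (ν a : ℝ), 0 < ν → 0 < a → ∀ (B : E3 →L[ℝ] E3) (U : E3 → E3) (P : E3 → ℝ),
      ContDiff ℝ (⊤ : ℕ∞) U → ContDiff ℝ 2 P → (∀ x, inner ℝ (B x) x = 0) →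
      Literature.Analysis.FluidPDE.VectorCalculus.IsDivFree U →
      (∀ y, -(ν • Laplacian.laplacian U y) + a • U y + a • fderiv ℝ U y y
        + (B (U y) - fderiv ℝ U y (B y)) + Literature.Analysis.FluidPDE.convect U U y
        + gradient P y = 0) →
      (∃ M : ℝ, ∀ y, ‖U y‖ ≤ M) →
      (∀ ε : ℝ, 0 < ε → ∃ R : ℝ, ∀ y, R ≤ ‖y‖ →
        ‖y‖ * ‖fderiv ℝ U y‖ + ‖y‖ ^ 2 * ‖iteratedFDeriv ℝ 2 U y‖ ≤ ε) := by
  sorry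

/-- **stub K1b — `stub_farFieldLimit` (support, M/L; sketch-proved in `Lines/far_field_constancy.md` rev 4–5).**  Scale-natural
derivative decay forces a uniform far-field LIMIT: `∃ b, U(y) → b` as `‖y‖ → ∞`.  Proof sketch: `div((V·∇)U + (aI+B)U) = 0`
for skew `B`, so `ΔP = −tr((DU)²) = O(ε(r)²/r²)`; the Newtonian potential `P₁` of `ΔP` has `∇P₁ → 0` (shell estimate);
`∇P` is bounded (equation + K1a + `U` bounded), so `H = P − P₁` is harmonic with bounded gradient ⇒ `∇H ≡ g` ⇒ `∇P → g`;
along the outward characteristics of `V` (`|y(s)| ≍ e^(as)`): `dU/ds + (aI+B)U = −g + o(1)` ⇒ `U → b = −(aI+B)⁻¹ g`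
uniformly in the direction.  Why it might fail: it should not — every step is classical (Newtonian-potential shell
estimate, harmonic Liouville, linear ODE with decaying forcing); the only care is the `o(1)` being uniform over directions,
which the `ε`–`R` form of K1a provides.  Sources: GilbargTrudinger §2.4, §4.2; the line card rev 3–4 (P4′ executed).
[status: open] -/
theorem stub_farFieldLimit :
    ∀ (ν a : ℝ), 0 < ν → 0 < a → ∀ (B : E3 →L[ℝ] E3) (U : E3 → E3) (P : E3 → ℝ),
      ContDiff ℝ (⊤ : ℕ∞) U → ContDiff ℝ 2 P → (∀ x, inner ℝ (B x) x = 0) →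
      Literature.Analysis.FluidPDE.VectorCalculus.IsDivFree U →
      (∀ y, -(ν • Laplacian.laplacian U y) + a • U y + a • fderiv ℝ U y y
        + (B (U y) - fderiv ℝ U y (B y)) + Literature.Analysis.FluidPDE.convect U U y
        + gradient P y = 0) →
      (∃ M : ℝ, ∀ y, ‖U y‖ ≤ M) →
      (∀ ε : ℝ, 0 < ε → ∃ R : ℝ, ∀ y, R ≤ ‖y‖ →
        ‖y‖ * ‖fderiv ℝ U y‖ + ‖y‖ ^ 2 * ‖iteratedFDeriv ℝ 2 U y‖ ≤ ε) →
      ∃ b : E3, (∀ ε : ℝ, 0 < ε → ∃ R : ℝ, ∀ y, R ≤ ‖y‖ → ‖U y - b‖ ≤ ε) := by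
  sorry

/-- **stub K1c — `stub_typeIRate` (crux, rank 3 of the line; borderline rate lemma; L/XL).**  A bounded profile with
scale-natural derivative decay that tends to `b` at infinity does so AT THE TYPE-I RATE: `‖U(y) − b‖ ≤ K/(1+‖y‖)`.
Why it might fail: the homogeneous decay along characteristics, `e^(−as) = r₀/r`, is exactly the target rate, so a forcing
that is merely `o(1/r)·O(1)` loses a logarithm — `(log r)/r` — unless the bootstrap gains a power (`ε(r) ≤ r^(−δ)`); angular
regularity at scale `r` is not automatic (Δ acts at scale 1).  Equivalent reading: an ε-regularity statement for rotated
self-similar solutions at `(x₀, T)`, `x₀ ≠ 0`, under rate-free smallness — Pineau–Vicol Prop. 3.1 flavour, below `L^(3,∞)`.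
Recentring by the landed `farField_translationCovariance` (or its `o(1)` variant) may be used first (it turns `b·∇U` into a
quadratic term).  Sources: PineauVicol2026 Prop. 3.1, (1.9); JiaSverak2014 §4; Tsai1998. [status: open] -/
theorem stub_typeIRate :
    ∀ (ν a : ℝ), 0 < ν → 0 < a → ∀ (B : E3 →L[ℝ] E3) (U : E3 → E3) (P : E3 → ℝ),
      ContDiff ℝ (⊤ : ℕ∞) U → ContDiff ℝ 2 P → (∀ x, inner ℝ (B x) x = 0) →
      Literature.Analysis.FluidPDE.VectorCalculus.IsDivFree U →
      (∀ y, -(ν • Laplacian.laplacian U y) + a • U y + a • fderiv ℝ U y y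
        + (B (U y) - fderiv ℝ U y (B y)) + Literature.Analysis.FluidPDE.convect U U y
        + gradient P y = 0) →
      (∃ M : ℝ, ∀ y, ‖U y‖ ≤ M) →
      (∀ ε : ℝ, 0 < ε → ∃ R : ℝ, ∀ y, R ≤ ‖y‖ →
        ‖y‖ * ‖fderiv ℝ U y‖ + ‖y‖ ^ 2 * ‖iteratedFDeriv ℝ 2 U y‖ ≤ ε) →
      ∀ b : E3, (∀ ε : ℝ, 0 < ε → ∃ R : ℝ, ∀ y, R ≤ ‖y‖ → ‖U y - b‖ ≤ ε) →
      ∃ K : ℝ, ∀ y, ‖U y - b‖ ≤ K / (1 + ‖y‖) := by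
  sorry

/-- **K1 from its glued split (kernel-checked): K1a → K1b → K1c → K1** (`stub_farFieldConstancy` of v1, statement
verbatim: bounded profile ⇒ `∃ b K, ‖U y − b‖ ≤ K/(1+‖y‖)`).  Three lines of logic. -/
theorem farFieldConstancy_of
    (hA : ∀ (ν a : ℝ), 0 < ν → 0 < a → ∀ (B : E3 →L[ℝ] E3) (U : E3 → E3) (P : E3 → ℝ),
      ContDiff ℝ (⊤ : ℕ∞) U → ContDiff ℝ 2 P → (∀ x, inner ℝ (B x) x = 0) →
      Literature.Analysis.FluidPDE.VectorCalculus.IsDivFree U →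
      (∀ y, -(ν • Laplacian.laplacian U y) + a • U y + a • fderiv ℝ U y y
        + (B (U y) - fderiv ℝ U y (B y)) + Literature.Analysis.FluidPDE.convect U U y
        + gradient P y = 0) →
      (∃ M : ℝ, ∀ y, ‖U y‖ ≤ M) →
      (∀ ε : ℝ, 0 < ε → ∃ R : ℝ, ∀ y, R ≤ ‖y‖ →
        ‖y‖ * ‖fderiv ℝ U y‖ + ‖y‖ ^ 2 * ‖iteratedFDeriv ℝ 2 U y‖ ≤ ε))
    (hB : ∀ (ν a : ℝ), 0 < ν → 0 < a → ∀ (B : E3 →L[ℝ] E3) (U : E3 → E3) (P : E3 → ℝ),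
      ContDiff ℝ (⊤ : ℕ∞) U → ContDiff ℝ 2 P → (∀ x, inner ℝ (B x) x = 0) →
      Literature.Analysis.FluidPDE.VectorCalculus.IsDivFree U →
      (∀ y, -(ν • Laplacian.laplacian U y) + a • U y + a • fderiv ℝ U y y
        + (B (U y) - fderiv ℝ U y (B y)) + Literature.Analysis.FluidPDE.convect U U y
        + gradient P y = 0) →
      (∃ M : ℝ, ∀ y, ‖U y‖ ≤ M) →
      (∀ ε : ℝ, 0 < ε → ∃ R : ℝ, ∀ y, R ≤ ‖y‖ →
        ‖y‖ * ‖fderiv ℝ U y‖ + ‖y‖ ^ 2 * ‖iteratedFDeriv ℝ 2 U y‖ ≤ ε) →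
      ∃ b : E3, (∀ ε : ℝ, 0 < ε → ∃ R : ℝ, ∀ y, R ≤ ‖y‖ → ‖U y - b‖ ≤ ε))
    (hC : ∀ (ν a : ℝ), 0 < ν → 0 < a → ∀ (B : E3 →L[ℝ] E3) (U : E3 → E3) (P : E3 → ℝ),
      ContDiff ℝ (⊤ : ℕ∞) U → ContDiff ℝ 2 P → (∀ x, inner ℝ (B x) x = 0) →
      Literature.Analysis.FluidPDE.VectorCalculus.IsDivFree U →
      (∀ y, -(ν • Laplacian.laplacian U y) + a • U y + a • fderiv ℝ U y y
        + (B (U y) - fderiv ℝ U y (B y)) + Literature.Analysis.FluidPDE.convect U U y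
        + gradient P y = 0) →
      (∃ M : ℝ, ∀ y, ‖U y‖ ≤ M) →
      (∀ ε : ℝ, 0 < ε → ∃ R : ℝ, ∀ y, R ≤ ‖y‖ →
        ‖y‖ * ‖fderiv ℝ U y‖ + ‖y‖ ^ 2 * ‖iteratedFDeriv ℝ 2 U y‖ ≤ ε) →
      ∀ b : E3, (∀ ε : ℝ, 0 < ε → ∃ R : ℝ, ∀ y, R ≤ ‖y‖ → ‖U y - b‖ ≤ ε) →
      ∃ K : ℝ, ∀ y, ‖U y - b‖ ≤ K / (1 + ‖y‖)) :
    ∀ (ν a : ℝ), 0 < ν → 0 < a → ∀ (B : E3 →L[ℝ] E3) (U : E3 → E3) (P : E3 → ℝ),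
      ContDiff ℝ (⊤ : ℕ∞) U → ContDiff ℝ 2 P → (∀ x, inner ℝ (B x) x = 0) →
      Literature.Analysis.FluidPDE.VectorCalculus.IsDivFree U →
      (∀ y, -(ν • Laplacian.laplacian U y) + a • U y + a • fderiv ℝ U y y
        + (B (U y) - fderiv ℝ U y (B y)) + Literature.Analysis.FluidPDE.convect U U y
        + gradient P y = 0) →
      (∃ M : ℝ, ∀ y, ‖U y‖ ≤ M) →
      ∃ (b : E3) (K : ℝ), ∀ y, ‖U y - b‖ ≤ K / (1 + ‖y‖) := by
  intro ν a hν ha B U P hU hP hskew hdiv heq hbdd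
  have hdecay := hA ν a hν ha B U P hU hP hskew hdiv heq hbdd
  obtain ⟨b, hb⟩ := hB ν a hν ha B U P hU hP hskew hdiv heq hbdd hdecay
  obtain ⟨K, hK⟩ := hC ν a hν ha B U P hU hP hskew hdiv heq hbdd hdecay b hb
  exact ⟨b, K, hK⟩

/-- **stub R1 — `stub_pineauVicolConjecture` (DECLARED RESIDUAL = Pineau–Vicol Conjecture 1.1 AS PRINTED, profile form,
printed frame `(ν, a, B) = (1, ½, αJ)`, `α ≠ 0`, `J = rotGen`; XL, named open problem).**  «Let `α ≠ 0` and `U` a smooth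
solution of (1.8) on `ℝ³`; if `|U(y)| ≤ C/(1+|y|)` then `U ≡ 0`.»  This is the right-hand side of the landed
`Theorems.CoriolisHead.decayingRotatedLiouville_iff_pineauVicolFrame`, so the residual is the printed open problem, neither
more nor less; the general frame (every `ν, a > 0`, every skew `B`) follows by the landed
`decayingRotatedLiouville_of_pineauVicolFrame` (parabolic scaling + skew normal form + rotation covariance; `B = 0` is Tsai's
theorem in the tree).  Decided in print at extreme rates `|α| < α₁(C)` or `> α₂(C)` (PineauVicol2026 Thm 1.4; tree fact
`pineauVicol2026_rss_liouville`); OPEN at `|α| ≈ 1` (as a `λ`-DSS Liouville problem, `λ = e^(π/|α|)` is coarse there).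
Why it might fail: a genuine rotated self-similar blow-up profile at intermediate rotation rate (none known; PineauVicol2026
Rem. 1.2).  Sources: PineauVicol2026 Conj. 1.1, Thm 1.4; Tsai1998 Thm 1. [status: open] -/
theorem stub_pineauVicolConjecture :
    ∀ α : ℝ, α ≠ 0 →
      ∀ (U : E3 → E3) (P : E3 → ℝ),
      ContDiff ℝ (⊤ : ℕ∞) U → ContDiff ℝ 2 P →
      Literature.Analysis.FluidPDE.VectorCalculus.IsDivFree U →
      (∀ y, α • (rotGen (U y) - fderiv ℝ U y (rotGen y)) + (1 / 2 : ℝ) • U y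
        + (1 / 2 : ℝ) • fderiv ℝ U y y - Laplacian.laplacian U y
        + Literature.Analysis.FluidPDE.convect U U y + gradient P y = 0) →
      (∃ K : ℝ, ∀ y, ‖U y‖ ≤ K / (1 + ‖y‖)) →
      ∀ y, U y = 0 := by
  sorry

/-- **Composition, part 1 (kernel-checked; v1 verbatim): K1 (far-field constancy), P1 (translation covariance — LANDED,
`farField_translationCovariance`), R1 (decaying rotated Liouville) ⟹ the bounded rotated-profile Liouville statement `X`**
(the right-hand side of `noCoRotatingCore_iff_rotatedProfileLiouville`).  Far-field constancy gives the asymptotic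
constant `b`; translation covariance recentres to a decaying profile; the residual kills it; undo the translation. -/
theorem rotatedProfileLiouville_of
    (h₁ : ∀ (ν a : ℝ), 0 < ν → 0 < a → ∀ (B : E3 →L[ℝ] E3) (U : E3 → E3) (P : E3 → ℝ),
      ContDiff ℝ (⊤ : ℕ∞) U → ContDiff ℝ 2 P → (∀ x, inner ℝ (B x) x = 0) →
      Literature.Analysis.FluidPDE.VectorCalculus.IsDivFree U →
      (∀ y, -(ν • Laplacian.laplacian U y) + a • U y + a • fderiv ℝ U y y
        + (B (U y) - fderiv ℝ U y (B y)) + Literature.Analysis.FluidPDE.convect U U y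
        + gradient P y = 0) →
      (∃ M : ℝ, ∀ y, ‖U y‖ ≤ M) →
      ∃ (b : E3) (K : ℝ), ∀ y, ‖U y - b‖ ≤ K / (1 + ‖y‖))
    (h₂ : ∀ (ν a : ℝ), 0 < ν → 0 < a → ∀ (B : E3 →L[ℝ] E3) (U : E3 → E3) (P : E3 → ℝ),
      ContDiff ℝ (⊤ : ℕ∞) U → ContDiff ℝ 2 P → (∀ x, inner ℝ (B x) x = 0) →
      Literature.Analysis.FluidPDE.VectorCalculus.IsDivFree U →
      (∀ y, -(ν • Laplacian.laplacian U y) + a • U y + a • fderiv ℝ U y y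
        + (B (U y) - fderiv ℝ U y (B y)) + Literature.Analysis.FluidPDE.convect U U y
        + gradient P y = 0) →
      ∀ (b : E3) (K : ℝ), (∀ y, ‖U y - b‖ ≤ K / (1 + ‖y‖)) →
      ∃ (y₀ : E3) (P' : E3 → ℝ) (K' : ℝ),
        a • y₀ - B y₀ = -b ∧
        ContDiff ℝ (⊤ : ℕ∞) (fun y => U (y + y₀) - b) ∧ ContDiff ℝ 2 P' ∧
        Literature.Analysis.FluidPDE.VectorCalculus.IsDivFree (fun y => U (y + y₀) - b) ∧
        (∀ y, -(ν • Laplacian.laplacian (fun y => U (y + y₀) - b) y) + a • (fun y => U (y + y₀) - b) y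
          + a • fderiv ℝ (fun y => U (y + y₀) - b) y y
          + (B ((fun y => U (y + y₀) - b) y) - fderiv ℝ (fun y => U (y + y₀) - b) y (B y))
          + Literature.Analysis.FluidPDE.convect (fun y => U (y + y₀) - b) (fun y => U (y + y₀) - b) y
          + gradient P' y = 0) ∧
        (∀ y, ‖(fun y => U (y + y₀) - b) y‖ ≤ K' / (1 + ‖y‖)))
    (h₃ : ∀ (ν a : ℝ), 0 < ν → 0 < a → ∀ (B : E3 →L[ℝ] E3) (U : E3 → E3) (P : E3 → ℝ),
      ContDiff ℝ (⊤ : ℕ∞) U → ContDiff ℝ 2 P → (∀ x, inner ℝ (B x) x = 0) →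
      Literature.Analysis.FluidPDE.VectorCalculus.IsDivFree U →
      (∀ y, -(ν • Laplacian.laplacian U y) + a • U y + a • fderiv ℝ U y y
        + (B (U y) - fderiv ℝ U y (B y)) + Literature.Analysis.FluidPDE.convect U U y
        + gradient P y = 0) →
      (∃ K : ℝ, ∀ y, ‖U y‖ ≤ K / (1 + ‖y‖)) →
      ∀ y, U y = 0) :
    ∀ (ν a : ℝ), 0 < ν → 0 < a → ∀ (B : E3 →L[ℝ] E3) (U : E3 → E3) (P : E3 → ℝ),
      ContDiff ℝ (⊤ : ℕ∞) U → ContDiff ℝ 2 P → (∀ x, inner ℝ (B x) x = 0) →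
      Literature.Analysis.FluidPDE.VectorCalculus.IsDivFree U →
      (∀ y, -(ν • Laplacian.laplacian U y) + a • U y + a • fderiv ℝ U y y
        + (B (U y) - fderiv ℝ U y (B y)) + Literature.Analysis.FluidPDE.convect U U y
        + gradient P y = 0) →
      (∃ M : ℝ, ∀ y, ‖U y‖ ≤ M) → ∃ b : E3, ∀ y, U y = b := by
  intro ν a hν ha B U P hU hP hB hdiv heq hbdd
  obtain ⟨b, K, hbK⟩ := h₁ ν a hν ha B U P hU hP hB hdiv heq hbdd
  obtain ⟨y₀, P', K', _hy₀, hU', hP', hdiv', heq', hdec'⟩ := h₂ ν a hν ha B U P hU hP hB hdiv heq b K hbK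
  have hzero : ∀ y, (fun y => U (y + y₀) - b) y = 0 :=
    h₃ ν a hν ha B (fun y => U (y + y₀) - b) P' hU' hP' hB hdiv' heq' ⟨K', hdec'⟩
  refine ⟨b, fun y => ?_⟩
  have h := hzero (y - y₀)
  simp only [sub_add_cancel] at h
  exact sub_eq_zero.mp h

/-- **Composition, part 2 (kernel-checked): the four REGISTERED stubs ⟹ the crux `CoriolisHead.NoCoRotatingCore` BY NAME**,
through the landed equivalence `noCoRotatingCore_iff_rotatedProfileLiouville` (which uses the route's PROVED support
`CounterRotatingLiouville`, stmt-22677), the landed P1 `farField_translationCovariance` and the landed frame reduction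
`decayingRotatedLiouville_of_pineauVicolFrame`.  `NoCoRotatingCore`, `SpiralScalingLiouville` and Navier–Stokes regularity are
NOT proved: K1a, K1c and the residual are open, K1b is sketch-proved only.  This is the form `ledger skeleton check` reads
(no hypotheses; the stubs enter by name). -/
theorem NoCoRotatingCore_of : CoriolisHead.NoCoRotatingCore :=
  noCoRotatingCore_iff_rotatedProfileLiouville.mpr
    (rotatedProfileLiouville_of
      (farFieldConstancy_of stub_scaleNaturalDecay stub_farFieldLimit stub_typeIRate)
      farField_translationCovariance
      (decayingRotatedLiouville_of_pineauVicolFrame stub_pineauVicolConjecture))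

end Summit.NavierStokesRegularity.NavierStokesRegularity.Cruxes.NoCoRotatingCore.FarFieldConstancy
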